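import Summits.AnomalousDissipation.AnomalousDissipation.Theorems.ScalarAnomalySteadySourceFormal.Negative.KillShape
import HarnessLib

/-!
# Load-bearing hypotheses of the transfer stubs of line `budgeted-mixer-template`
(crux `TwoAndHalfD.ScalarAnomalySteadySourceFormal`, stmt-AnomalousDissipation-0448) — drefute seat.

`stub_dissipationFromPower_false_without_bound`: the variance hypothesis `‖θ(t)‖² ≤ B` of
`stub_dissipationFromPower` (S4) cannot be dropped. Witness at the `κ = 0` edge the stub admits:
flow at rest, constant source `h = 1`, `θ(t, x) = t` — a classical solution of
`∂ₜθ + u·∇θ = κΔθ + h` on `[0, ∞)` whose input power `∫ h θ(t) = t` is eventually `≥ 1` while the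
dissipation observable is identically `0` (`longTimeAvgSup_const`). So "power = dissipation in the
mean" genuinely consumes `‖θ(T)‖²/T → 0`; at `κ > 0` and rest no such witness exists (the cold start
converges), i.e. `B` bites exactly at `κ = 0`.  [folklore: DoeringFoias2002 §2]
-/

open MeasureTheory Set Filter
open _root_.Topology
open scoped InnerProductSpace

noncomputable section

namespace Summit.AnomalousDissipation.AnomalousDissipation.Theorems.ScalarAnomalySteadySourceFormal.Negative

open Literature.Analysis Literature.Analysis.FunctionSpaces
open Literature.Analysis.FluidPDE Literature.Analysis.FluidPDE.Torus

set_option linter.dupNamespace false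

/-- The flow at rest on `T²`. -/
private theorem isDivFree_zero_field :
    FunctionSpaces.Torus.IsDivFree (fun _ : UnitAddTorus (Fin 2) => (0 : EuclideanSpace ℝ (Fin 2))) := by
  intro x
  simp [FunctionSpaces.Torus.divergence, FunctionSpaces.Torus.partialDeriv, FunctionSpaces.Torus.lineDeriv]

/-- `θ(t, x) = t` is a classical solution of `∂ₜθ + 0·∇θ = 0·Δθ + 1` on `[0, ∞) × T²`. [folklore] -/
theorem linearGrowth_isClassical :
    IsClassicalScalarTransportForcedOn (Ici (0 : ℝ)) 0
      (fun (_ : ℝ) (_ : UnitAddTorus (Fin 2)) => (0 : EuclideanSpace ℝ (Fin 2)))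
      (fun (_ : ℝ) (_ : UnitAddTorus (Fin 2)) => (1 : ℝ))
      (fun (t : ℝ) (_ : UnitAddTorus (Fin 2)) => t) where
  smooth_velocity := contDiffOn_const
  smooth_source := contDiffOn_const
  smooth_scalar := by
    have h : FunctionSpaces.Torus.stLift (fun (t : ℝ) (_ : UnitAddTorus (Fin 2)) => t) = Prod.fst := by
      funext z; rfl
    unfold FunctionSpaces.Torus.IsSmoothSpaceTimeOn
    rw [h]
    exact contDiff_fst.contDiffOn
  transport := fun t ht x => by
    have hd : FunctionSpaces.Torus.timeDerivWithin (Ici (0 : ℝ))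
        (fun (t : ℝ) (_ : UnitAddTorus (Fin 2)) => t) t x = 1 := by
      have h1 : HasDerivWithinAt (fun τ : ℝ => τ) 1 (Ici (0 : ℝ)) t := hasDerivWithinAt_id t _
      exact h1.derivWithin (uniqueDiffOn_Ici 0 t ht)
    rw [hd, inner_zero_left, zero_mul]
    ring
  divFree := fun _ _ => isDivFree_zero_field

/-- **S4 without the variance bound is false.** Deleting `∀ t ≥ 0, ‖θ(t)‖² ≤ B` from
`stub_dissipationFromPower` leaves a false statement: `κ = 0`, `u = 0`, `h = 1`, `θ(t,x) = t`,
`e = 1`, `t₀ = 1` (input power `t ≥ 1`, dissipation observable `≡ 0`). [folklore] -/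
theorem stub_dissipationFromPower_false_without_bound :
    ¬ (∀ (κ e t₀ : ℝ) (u : ℝ → UnitAddTorus (Fin 2) → EuclideanSpace ℝ (Fin 2))
        (h : UnitAddTorus (Fin 2) → ℝ) (θ : ℝ → UnitAddTorus (Fin 2) → ℝ),
        0 ≤ κ →
        IsClassicalScalarTransportForcedOn (Set.Ici 0) κ u (fun _ => h) θ →
        (∀ t, t₀ ≤ t → e ≤ ∫ x, h x * θ t x) →
        e ≤ longTimeAvgSup (fun t => κ * (eScalarGradNormSq (θ t)).toReal)) := by
  intro H
  have hpow : ∀ t : ℝ, (1 : ℝ) ≤ t →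
      (1 : ℝ) ≤ ∫ x : UnitAddTorus (Fin 2), (1 : ℝ) * (fun (t : ℝ) (_ : UnitAddTorus (Fin 2)) => t) t x := by
    intro t ht
    simpa [integral_const] using ht
  have key := H 0 1 1 (fun _ _ => 0) (fun _ => 1) (fun t _ => t) le_rfl linearGrowth_isClassical hpow
  simp only [zero_mul] at key
  rw [longTimeAvgSup_const] at key
  linarith

end Summit.AnomalousDissipation.AnomalousDissipation.Theorems.ScalarAnomalySteadySourceFormal.Negative

end
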